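import Mathlib
import Literature.Analysis.FluidPDE.VectorCalculus
import Literature.Analysis.FluidPDE.LeiZhang2011Proofs
import Literature.Analysis.FluidPDE.TaoAveragedNondegeneracy
import Summits.NavierStokesRegularity.NavierStokesRegularity.Theorems.CorkscrewDynamoWindDynamoExists
import Summits.NavierStokesRegularity.NavierStokesRegularity.Theorems.FilamentSkeletonRssSkeletonEquilibriumRadialEndTools

/-!
# Grönwall shadowing for the forced outer ODE (tools stub `stub_outerShadowingGronwall`, line `zero-accretion-selection`)

The inner-shadowing step of the XL core compares a witness filament in outer variables, which solves the
OUTER ODE up to a forcing, `Y″ = β • Y′ × A Y + f`, `‖f‖ ≤ η` (`A y = ½y − α e₃×y`; `η ~ 1/log Γ` from the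
e-uniform LIA layer), with the exact solution `Yo` through the same initial data. On a window where both
stay in `‖Y‖ ≤ ρ₁`, `‖Y′‖ ≤ 2` the first-order system `(Y, Y′)` has a Lipschitz field with constant
`K = 1 + |β|(½+|α|)(ρ₁+2)` (sup norm on `E × E`), so Mathlib's
`dist_le_of_approx_trajectories_ODE_of_mem` gives `‖Y − Yo‖, ‖Y′ − Yo′‖ ≤ (η/K)(e^{K(t−a)} − 1)`.
-/

noncomputable section

open Set Literature.Analysis.FluidPDE Literature.Analysis.FluidPDE.Tao2016
open scoped RealInnerProductSpace NNReal

namespace Summit.NavierStokesRegularity.NavierStokesRegularity.Theorems.SkeletonEquilibrium.ZeroAccretionSelection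
set_option linter.dupNamespace false

/-- `(a − b) × c = a × c − b × c`. [folklore] -/
theorem cross_sub_left' (a b c : EuclideanSpace ℝ (Fin 3)) : cross (a - b) c = cross a c - cross b c := by
  ext i
  fin_cases i <;> simp [cross_apply_zero, cross_apply_one, cross_apply_two] <;> ring

/-- **Lipschitz bound of the outer field** on `{‖y‖ ≤ ρ₁, ‖u‖ ≤ 2}` in the sup norm of `E × E`:
constant `1 + |β|(½+|α|)(ρ₁+2)`. [folklore] -/
theorem outerField_lipschitzOn (β α ρ₁ : ℝ) (hρ₁ : 0 ≤ ρ₁) :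
    LipschitzOnWith (Real.toNNReal (1 + |β| * (1 / 2 + |α|) * (ρ₁ + 2)))
      (fun z : EuclideanSpace ℝ (Fin 3) × EuclideanSpace ℝ (Fin 3) =>
      (z.2, β • cross z.2 ((1 / 2 : ℝ) • z.1 - α • cross (EuclideanSpace.single (2 : Fin 3) (1 : ℝ)) z.1)))
      {z | ‖z.1‖ ≤ ρ₁ ∧ ‖z.2‖ ≤ 2} := by
  set outerField := (fun z : EuclideanSpace ℝ (Fin 3) × EuclideanSpace ℝ (Fin 3) =>
      (z.2, β • cross z.2 ((1 / 2 : ℝ) • z.1 - α • cross (EuclideanSpace.single (2 : Fin 3) (1 : ℝ)) z.1))) with houter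
  rw [lipschitzOnWith_iff_norm_sub_le]
  intro z hz z' hz'
  have hK : (0 : ℝ) ≤ 1 + |β| * (1 / 2 + |α|) * (ρ₁ + 2) := by positivity
  rw [Real.coe_toNNReal _ hK]
  set e3 := (EuclideanSpace.single (2 : Fin 3) (1 : ℝ)) with he3
  set A : EuclideanSpace ℝ (Fin 3) → EuclideanSpace ℝ (Fin 3) :=
    fun y => (1 / 2 : ℝ) • y - α • cross e3 y with hA
  have hAlin : ∀ y y', A y - A y' = A (y - y') := by
    intro y y'
    simp only [hA]
    rw [← crossCLM_apply, ← crossCLM_apply, ← crossCLM_apply, map_sub, smul_sub, smul_sub]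
    abel
  have hdz : ‖z.1 - z'.1‖ ≤ ‖z - z'‖ := by
    have := norm_fst_le (z - z'); simpa using this
  have hdu : ‖z.2 - z'.2‖ ≤ ‖z - z'‖ := by
    have := norm_snd_le (z - z'); simpa using this
  -- the two components of the difference
  have h1 : ‖(outerField z - outerField z').1‖ ≤ (1 + |β| * (1 / 2 + |α|) * (ρ₁ + 2)) * ‖z - z'‖ := by
    simp only [houter, Prod.fst_sub]
    calc ‖z.2 - z'.2‖ ≤ ‖z - z'‖ := hdu
      _ = 1 * ‖z - z'‖ := (one_mul _).symm
      _ ≤ (1 + |β| * (1 / 2 + |α|) * (ρ₁ + 2)) * ‖z - z'‖ := by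
          gcongr; linarith [show (0:ℝ) ≤ |β| * (1 / 2 + |α|) * (ρ₁ + 2) by positivity]
  have h2 : ‖(outerField z - outerField z').2‖ ≤ (1 + |β| * (1 / 2 + |α|) * (ρ₁ + 2)) * ‖z - z'‖ := by
    simp only [houter, Prod.snd_sub]
    change ‖β • cross z.2 (A z.1) - β • cross z'.2 (A z'.1)‖ ≤ _
    have e : β • cross z.2 (A z.1) - β • cross z'.2 (A z'.1) =
        β • (cross (z.2 - z'.2) (A z.1) + cross z'.2 (A z.1 - A z'.1)) := by
      rw [← smul_sub]
      congr 1
      conv_rhs => rw [cross_sub_left' z.2 z'.2 (A z.1), windCross_sub_right z'.2 (A z.1) (A z'.1)]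
      abel
    rw [e, norm_smul, Real.norm_eq_abs, hAlin]
    have hAz : ‖A z.1‖ ≤ (1 / 2 + |α|) * ρ₁ :=
      (norm_drift_le α z.1).trans (mul_le_mul_of_nonneg_left hz.1 (by positivity))
    have hAd : ‖A (z.1 - z'.1)‖ ≤ (1 / 2 + |α|) * ‖z - z'‖ :=
      (norm_drift_le α _).trans (mul_le_mul_of_nonneg_left hdz (by positivity))
    calc |β| * ‖cross (z.2 - z'.2) (A z.1) + cross z'.2 (A (z.1 - z'.1))‖
        ≤ |β| * (‖cross (z.2 - z'.2) (A z.1)‖ + ‖cross z'.2 (A (z.1 - z'.1))‖) := by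
          gcongr; exact norm_add_le _ _
      _ ≤ |β| * (‖z.2 - z'.2‖ * ‖A z.1‖ + ‖z'.2‖ * ‖A (z.1 - z'.1)‖) := by
          gcongr <;> exact norm_cross_le_norm_mul_norm _ _
      _ ≤ |β| * (‖z - z'‖ * ((1 / 2 + |α|) * ρ₁) + 2 * ((1 / 2 + |α|) * ‖z - z'‖)) := by
          gcongr
          · exact hz'.2
      _ = |β| * (1 / 2 + |α|) * (ρ₁ + 2) * ‖z - z'‖ := by ring
      _ ≤ (1 + |β| * (1 / 2 + |α|) * (ρ₁ + 2)) * ‖z - z'‖ := by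
          gcongr; linarith
  calc ‖outerField z - outerField z'‖
      = max ‖(outerField z - outerField z').1‖ ‖(outerField z - outerField z').2‖ :=
        Prod.norm_def _
    _ ≤ (1 + |β| * (1 / 2 + |α|) * (ρ₁ + 2)) * ‖z - z'‖ := max_le h1 h2

/-- **Grönwall shadowing for the forced outer ODE.** Let `Y` be `C²` with
`‖Y″ − β • Y′ × A Y‖ ≤ η` on `[a, b]`, `Yo` a `C²` exact solution (`Yo″ = β • Yo′ × A Yo`) with the same data
at `a`, and suppose both stay in `‖·‖ ≤ ρ₁`, `‖·′‖ ≤ 2` on `[a, b]`. Then with `K = 1 + |β|(½+|α|)(ρ₁+2)`,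
`‖Y t − Yo t‖` and `‖Y′ t − Yo′ t‖` are `≤ gronwallBound 0 K η (t − a) = (η/K)(e^{K(t−a)} − 1)` on `[a, b]`.
[folklore] -/
theorem outer_shadowing {β α ρ₁ η a b : ℝ} {Y Yo : ℝ → EuclideanSpace ℝ (Fin 3)}
    (hρ₁ : 0 ≤ ρ₁) (hY : ContDiff ℝ 2 Y) (hYo : ContDiff ℝ 2 Yo)
    (h0 : Y a = Yo a) (h0' : deriv Y a = deriv Yo a)
    (hin : ∀ t ∈ Icc a b, ‖Y t‖ ≤ ρ₁ ∧ ‖deriv Y t‖ ≤ 2 ∧ ‖Yo t‖ ≤ ρ₁ ∧ ‖deriv Yo t‖ ≤ 2)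
    (hf : ∀ t ∈ Icc a b, ‖deriv (deriv Y) t -
      β • cross (deriv Y t) ((1 / 2 : ℝ) • Y t - α • cross (EuclideanSpace.single (2 : Fin 3) (1 : ℝ)) (Y t))‖ ≤ η)
    (hode : ∀ t, deriv (deriv Yo) t =
      β • cross (deriv Yo t) ((1 / 2 : ℝ) • Yo t - α • cross (EuclideanSpace.single (2 : Fin 3) (1 : ℝ)) (Yo t))) :
    ∀ t ∈ Icc a b,
      ‖Y t - Yo t‖ ≤ gronwallBound 0 (1 + |β| * (1 / 2 + |α|) * (ρ₁ + 2)) η (t - a) ∧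
      ‖deriv Y t - deriv Yo t‖ ≤ gronwallBound 0 (1 + |β| * (1 / 2 + |α|) * (ρ₁ + 2)) η (t - a) := by
  -- phase-space trajectories
  set f : ℝ → EuclideanSpace ℝ (Fin 3) × EuclideanSpace ℝ (Fin 3) := fun t => (Y t, deriv Y t) with hfdef
  set g : ℝ → EuclideanSpace ℝ (Fin 3) × EuclideanSpace ℝ (Fin 3) := fun t => (Yo t, deriv Yo t) with hgdef
  set f' : ℝ → EuclideanSpace ℝ (Fin 3) × EuclideanSpace ℝ (Fin 3) := fun t => (deriv Y t, deriv (deriv Y) t)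
    with hf'def
  set g' : ℝ → EuclideanSpace ℝ (Fin 3) × EuclideanSpace ℝ (Fin 3) := fun t => (deriv Yo t, deriv (deriv Yo) t)
    with hg'def
  have hYd : Differentiable ℝ Y := hY.differentiable (by norm_num)
  have hYod : Differentiable ℝ Yo := hYo.differentiable (by norm_num)
  have hY'd : Differentiable ℝ (deriv Y) := hY.differentiable_deriv_two
  have hYo'd : Differentiable ℝ (deriv Yo) := hYo.differentiable_deriv_two
  have hfder : ∀ t, HasDerivAt f (f' t) t := fun t =>
    (hYd t).hasDerivAt.prodMk (hY'd t).hasDerivAt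
  have hgder : ∀ t, HasDerivAt g (g' t) t := fun t =>
    (hYod t).hasDerivAt.prodMk (hYo'd t).hasDerivAt
  have hfc : ContinuousOn f (Icc a b) := fun t _ => (hfder t).continuousAt.continuousWithinAt
  have hgc : ContinuousOn g (Icc a b) := fun t _ => (hgder t).continuousAt.continuousWithinAt
  have hK : (0 : ℝ) ≤ 1 + |β| * (1 / 2 + |α|) * (ρ₁ + 2) := by positivity
  have hlip := outerField_lipschitzOn β α ρ₁ hρ₁
  set outerField := (fun z : EuclideanSpace ℝ (Fin 3) × EuclideanSpace ℝ (Fin 3) =>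
      (z.2, β • cross z.2 ((1 / 2 : ℝ) • z.1 - α • cross (EuclideanSpace.single (2 : Fin 3) (1 : ℝ)) z.1))) with houter
  -- defects
  have hfb : ∀ t ∈ Ico a b, dist (f' t) (outerField (f t)) ≤ η := by
    intro t ht
    rw [dist_eq_norm, Prod.norm_def]
    simp only [hf'def, hfdef, houter, Prod.fst_sub, Prod.snd_sub, sub_self, norm_zero]
    exact max_le (le_trans (norm_nonneg _) (hf t (Ico_subset_Icc_self ht))) (hf t (Ico_subset_Icc_self ht))
  have hgb : ∀ t ∈ Ico a b, dist (g' t) (outerField (g t)) ≤ 0 := by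
    intro t _
    rw [dist_eq_norm, Prod.norm_def]
    simp [hg'def, hgdef, houter, hode t]
  have hfs : ∀ t ∈ Ico a b, f t ∈ {z : EuclideanSpace ℝ (Fin 3) × EuclideanSpace ℝ (Fin 3) | ‖z.1‖ ≤ ρ₁ ∧ ‖z.2‖ ≤ 2} :=
    fun t ht => ⟨(hin t (Ico_subset_Icc_self ht)).1, (hin t (Ico_subset_Icc_self ht)).2.1⟩
  have hgs : ∀ t ∈ Ico a b, g t ∈ {z : EuclideanSpace ℝ (Fin 3) × EuclideanSpace ℝ (Fin 3) | ‖z.1‖ ≤ ρ₁ ∧ ‖z.2‖ ≤ 2} :=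
    fun t ht => ⟨(hin t (Ico_subset_Icc_self ht)).2.2.1, (hin t (Ico_subset_Icc_self ht)).2.2.2⟩
  have hinit : dist (f a) (g a) ≤ 0 := by
    rw [dist_eq_norm, Prod.norm_def]
    simp [hfdef, hgdef, h0, h0']
  have key := dist_le_of_approx_trajectories_ODE_of_mem
    (v := fun _ => outerField) (s := fun _ => {z | ‖z.1‖ ≤ ρ₁ ∧ ‖z.2‖ ≤ 2})
    (fun t _ => hlip) hfc (fun t _ => (hfder t).hasDerivWithinAt) hfb hfs hgc
    (fun t _ => (hgder t).hasDerivWithinAt) hgb hgs hinit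
  intro t ht
  have h := key t ht
  rw [Real.coe_toNNReal _ hK, add_zero, dist_eq_norm] at h
  have h1 : ‖Y t - Yo t‖ ≤ ‖f t - g t‖ := by
    have := norm_fst_le (f t - g t); simpa using this
  have h2 : ‖deriv Y t - deriv Yo t‖ ≤ ‖f t - g t‖ := by
    have := norm_snd_le (f t - g t); simpa using this
  exact ⟨h1.trans h, h2.trans h⟩

/-- **Registered tools stub `stub_outerShadowingGronwall`** (line `zero-accretion-selection`; blueprint §4(b) of the
XL core `stub_zeroAccretionShadowing`): the Lipschitz bound of the outer field on a bounded phase-space box and the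
Grönwall shadowing of a forced outer trajectory by the exact one. [folklore] -/
theorem stub_outerShadowingGronwall :
    (∀ (β α ρ₁ : ℝ), 0 ≤ ρ₁ →
      LipschitzOnWith (Real.toNNReal (1 + |β| * (1 / 2 + |α|) * (ρ₁ + 2)))
        (fun z : EuclideanSpace ℝ (Fin 3) × EuclideanSpace ℝ (Fin 3) => (z.2, β • cross z.2 ((1 / 2 : ℝ) • z.1 - α • cross (EuclideanSpace.single (2 : Fin 3) (1 : ℝ)) z.1)))
        {z | ‖z.1‖ ≤ ρ₁ ∧ ‖z.2‖ ≤ 2}) ∧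
    (∀ (β α ρ₁ η a b : ℝ) (Y Yo : ℝ → EuclideanSpace ℝ (Fin 3)), 0 ≤ ρ₁ → ContDiff ℝ 2 Y → ContDiff ℝ 2 Yo →
      Y a = Yo a → deriv Y a = deriv Yo a →
      (∀ t ∈ Set.Icc a b, ‖Y t‖ ≤ ρ₁ ∧ ‖deriv Y t‖ ≤ 2 ∧ ‖Yo t‖ ≤ ρ₁ ∧ ‖deriv Yo t‖ ≤ 2) →
      (∀ t ∈ Set.Icc a b, ‖deriv (deriv Y) t -
        β • cross (deriv Y t) ((1 / 2 : ℝ) • Y t - α • cross (EuclideanSpace.single (2 : Fin 3) (1 : ℝ)) (Y t))‖ ≤ η) →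
      (∀ t, deriv (deriv Yo) t =
        β • cross (deriv Yo t) ((1 / 2 : ℝ) • Yo t - α • cross (EuclideanSpace.single (2 : Fin 3) (1 : ℝ)) (Yo t))) →
      ∀ t ∈ Set.Icc a b,
        ‖Y t - Yo t‖ ≤ gronwallBound 0 (1 + |β| * (1 / 2 + |α|) * (ρ₁ + 2)) η (t - a) ∧
        ‖deriv Y t - deriv Yo t‖ ≤ gronwallBound 0 (1 + |β| * (1 / 2 + |α|) * (ρ₁ + 2)) η (t - a)) :=
  ⟨fun β α ρ₁ hρ₁ => outerField_lipschitzOn β α ρ₁ hρ₁,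
    fun _ _ _ _ _ _ _ _ hρ₁ hY hYo h0 h0' hin hf hode => outer_shadowing hρ₁ hY hYo h0 h0' hin hf hode⟩

end Summit.NavierStokesRegularity.NavierStokesRegularity.Theorems.SkeletonEquilibrium.ZeroAccretionSelection
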